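import Summits.BirchSwinnertonDyer.BirchSwinnertonDyer.Theorems.ManinLocalTwoThreeManinOddOfOddEtaExponent
import Literature.NumberTheory.EllipticCurves.ModTwoReducibleIffTwoTorsionRoot
import Mathlib.RingTheory.Polynomial.RationalRoot
import HarnessLib

/-!
# The reducible residual `Rb` of `ManinOddAtFour` in an's normal form, from three named rows
# (K_geo E-an-48, E-an-53, E-an-50) — the certificate E-an-52 being a theorem

Summit `BirchSwinnertonDyer`, route `ManinLocalTwoThree` (cell bsd-f2-manin), deciding crux C2
`ManinOddAtFour` (stmt-BirchSwinnertonDyer-22967), stub 6 `stub_minimalReducibleResidual` (Rb) of the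
registered line `kato_shift_two`.  MEMO-an §56.6 «glue»: `C2|_{Rb} ⟸ model glue (a₁ = a₃ = 0) ∧ [∃ non-blind
T: K_geo(T) → (r,g,A,B); E-an-53 → odd δ; E-an-52 → c odd] ∧ [all T blind: E-an-50]`.  With E-an-52
(`ManinOddOfOddEtaExponent_holds`) and the dictionary «reducible `E[2]` ⟺ rational 2-torsion»
(`not_hasIrreducibleModPGaloisRep_two_iff_exists_isRoot_twoTorsionPolynomial`) now in the tree, this
file proves the glue BY NAME on globally minimal models with `a₁ = a₃ = 0` (always available at
additive `2`, MEMO-an §58.1; the registered stub quantifies over all globally minimal models — the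
`(1, 0, −a₁/2, −a₃/2)` transport of the parametrisation datum is NOT done here):

  `rbNormalForm_of_kgeo_of_oddExponent_of_blindResidual :
     CuspidalKummerRepresentativeAtFour → CuspidalKummerOddExponent → KummerBlindResidualOdd →
     ∀ W (minimal, a₁ = a₃ = 0) D (lattice-optimal), 4 ∣ N → ¬ W[2] irreducible → ¬ 2 ∣ c`.

Ingredients: a rational root `e` of the 2-division cubic (reducible `E[2]`), integral because
`x³ + a₂x² + a₄x + a₆` is monic over `ℤ` (rational root theorem); the germ `z = exp_{E_{W,c}}(Σ aₙqⁿ/n)`;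
either every rational root is Kummer-blind (E-an-50) or some root is non-blind, then K_geo gives a
cuspidal Kummer representative, E-an-53 an odd exponent, E-an-52 `2 ∤ c`.

HONEST FRAMING: a CONDITIONAL reduction — the three hypotheses are an's open rows (K_geo is a
generalized-Ogg statement at `4 ∣ N`; E-an-53 is C2-equivalent on its locus; E-an-50 is the totally
blind residual); nothing about BSD or Manin's conjecture is proved here.
-/

set_option autoImplicit false
set_option linter.dupNamespace false

noncomputable section

open scoped Classical
open PowerSeries Polynomial WeierstrassCurve Literature.NumberTheory.EllipticCurves
  Literature.NumberTheory.EllipticCurves.ModularForms Literature.RingTheory.FormalGroups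
open Summit.BirchSwinnertonDyer.Rank1Residual.ManinAdditive.CuspidalKummer

namespace Summit.BirchSwinnertonDyer.BirchSwinnertonDyer.Theorems.ManinLocalTwoThree

/-- On a model with `a₁ = a₃ = 0` and integral `a₂, a₄, a₆`, a rational root of the 2-division cubic
`4x³ + b₂x² + 2b₄x + b₆ = 4(x³ + a₂x² + a₄x + a₆)` is an integer (rational root theorem for the monic
integer cubic). [folklore] -/
theorem exists_int_eq_of_isRoot_twoTorsionPolynomial_of_a₁_a₃ (W : WeierstrassCurve ℚ) {a₂ a₄ a₆ : ℤ}
    (h₁ : W.a₁ = 0) (h₃ : W.a₃ = 0) (ha₂ : W.a₂ = a₂) (ha₄ : W.a₄ = a₄) (ha₆ : W.a₆ = a₆) {e : ℚ}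
    (he : W.twoTorsionPolynomial.toPoly.IsRoot e) : ∃ e₀ : ℤ, (e₀ : ℚ) = e := by
  have hcub : e ^ 3 + (a₂ : ℚ) * e ^ 2 + (a₄ : ℚ) * e + (a₆ : ℚ) = 0 := by
    have h := (isRoot_twoTorsionPolynomial_iff W e).mp he
    simp only [WeierstrassCurve.b₂, WeierstrassCurve.b₄, WeierstrassCurve.b₆, h₁, h₃, ha₂, ha₄, ha₆] at h
    linear_combination (1 / 4 : ℚ) * h
  set P : Cubic ℤ := ⟨1, a₂, a₄, a₆⟩ with hP
  have hmonic : P.toPoly.Monic := Cubic.monic_of_a_eq_one rfl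
  have haeval : aeval e P.toPoly = 0 := by
    simp only [hP, Cubic.toPoly, map_add, map_mul, map_pow, aeval_X, map_one, one_mul, eq_intCast,
      map_intCast]
    linear_combination hcub
  obtain ⟨e₀, he₀, -⟩ := exists_integer_of_is_root_of_monic hmonic haeval
  exact ⟨e₀, by rw [he₀, eq_intCast]⟩

/-- **Rb in normal form from an's three rows (MEMO-an §56.6 glue), E-an-52 discharged.**  Granting
K_geo (E-an-48 `CuspidalKummerRepresentativeAtFour`), E-an-53 (`CuspidalKummerOddExponent`) and the
blind residual (E-an-50 `KummerBlindResidualOdd`): for every globally minimal elliptic `W` with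
`a₁ = a₃ = 0`, every lattice-optimal `X₀(N)`-datum `D` with `4 ∣ N`, and `W[2]` REDUCIBLE, the Manin
constant is odd.  (Reducible `E[2]` = a rational root `e` of the 2-division cubic, an integer; the germ
`z = exp_{E_{W,c}}(Σ aₙqⁿ/n)`; if every rational root is Kummer-blind, E-an-50; otherwise K_geo gives a
cuspidal Kummer representative at a non-blind root, E-an-53 an odd `η`-exponent, and the tree theorem
E-an-52 `ManinOddOfOddEtaExponent_holds` the odd Manin constant.)  CONDITIONAL on the three rows; no
transport to models with `a₁a₃ ≠ 0`; nothing about BSD or Manin's conjecture is proved. [folklore] -/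
theorem rbNormalForm_of_kgeo_of_oddExponent_of_blindResidual
    (h48 : CuspidalKummerRepresentativeAtFour) (h53 : CuspidalKummerOddExponent)
    (h50 : KummerBlindResidualOdd) :
    ∀ (W : WeierstrassCurve ℚ) [W.IsElliptic] [W.IsGloballyMinimal] {N : ℕ} [NeZero N]
      (D : ModularParametrizationData W N),
      (∀ z ∈ D.L.lattice, ∃ w ∈ periodLattice D.f, z = D.c * w) → 4 ∣ N →
      W.a₁ = 0 → W.a₃ = 0 → ¬ W.HasIrreducibleModPGaloisRep 2 → ¬ (2 : ℤ) ∣ D.c := by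
  intro W hWell hWmin N hN D hopt h4 h₁ h₃ hred
  -- integral coefficients
  set M : WeierstrassCurve ℤ := integralModelInt W with hM
  have hWM : M.map (Int.castRingHom ℚ) = W := map_integralModelInt W
  have ha₂ : W.a₂ = (M.a₂ : ℚ) := by rw [← hWM, map_a₂, eq_intCast]
  have ha₄ : W.a₄ = (M.a₄ : ℚ) := by rw [← hWM, map_a₄, eq_intCast]
  have ha₆ : W.a₆ = (M.a₆ : ℚ) := by rw [← hWM, map_a₆, eq_intCast]
  -- a rational — hence integral — root of the 2-division cubic
  obtain ⟨e, he⟩ := W.exists_isRoot_twoTorsionPolynomial_of_not_hasIrreducibleModPGaloisRep_two hred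
  obtain ⟨e₀, rfl⟩ := exists_int_eq_of_isRoot_twoTorsionPolynomial_of_a₁_a₃ W h₁ h₃ ha₂ ha₄ ha₆ he
  -- the newform coefficients and the germ
  set a : ℕ → ℤ := fun n => W.LFunction n with ha
  have han : ∀ n, (a n : ℂ) = cuspCoeff D.f n := fun n => by rw [D.isNewformOf.2 n]
  set L : ℚ⟦X⟧ := lSeriesLog a with hL
  have hL0 : constantCoeff L = 0 := by
    rw [hL, lSeriesLog, ← coeff_zero_eq_constantCoeff, coeff_mk]; simp
  set z : ℚ⟦X⟧ := (shortModel W D.c).formalExp.subst L with hz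
  have hzg : IsParamGerm W D.c a z := by
    refine ⟨?_, ?_⟩
    · rw [hz, Literature.RingTheory.FormalGroups.constantCoeff_subst_of_constantCoeff_eq_zero hL0,
        constantCoeff_formalExp]
    · rw [hz, formalLog_subst_formalExp_subst _ hL0]
  -- blind or not
  by_cases hall : ∀ e : ℤ, W.twoTorsionPolynomial.toPoly.IsRoot (e : ℚ) → KummerBlindAtTwo M.a₂ M.a₄ e
  · exact h50 W D hopt h4 M.a₂ M.a₄ h₁ h₃ ha₂ ha₄ ⟨e₀, he⟩ hall
  · push Not at hall
    obtain ⟨e₁, he₁, hnb⟩ := hall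
    obtain ⟨r, g, A, B, hrep⟩ := h48 W D a han h4 hopt (e₁ : ℚ) he₁ z hzg
    have hodd := h53 W D a han h4 hopt M.a₂ M.a₄ e₁ h₁ h₃ ha₂ ha₄ he₁ hnb z hzg r g A B hrep
    exact ManinOddOfOddEtaExponent_holds W D a han h4 (e₁ : ℚ) he₁ z hzg r g A B hrep hodd

end Summit.BirchSwinnertonDyer.BirchSwinnertonDyer.Theorems.ManinLocalTwoThree

end
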